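import Literature.NumberTheory.EllipticCurves.Rank1Residual.GVParityTwistTransportProofs
import Literature.NumberTheory.EllipticCurves.Rank1Residual.X1RankZeroCertificate
import Literature.NumberTheory.EllipticCurves.BSDSelmerCMPConverseMaximalOrderProofs
import HarnessLib

/-!
# Class X1 is a property of the `ℚ`-isogeny class (cell `b2b-bsdres`, prover B, gen 5)

HONEST FRAMING (BSD rank-≤1 residual cell `b2b-bsdres`, home `run/shared/lean/b2b/bsd-rank1-residual/`,
unit `b2b-bsdres-x1b`, prover B = the independent patchwork, no Keller–Yin input; verbatim): the goal
is to DELETE the COMBINATION-SHAPED residual classes for ALL analytic-rank `≤ 1` curves over `ℚ` —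
"full BSD formula for every rank `≤ 1` curve in class C" assembled STRICTLY from published theorems —
so that the rank-`≤ 1` remainder becomes exactly the CONSTRUCTION-SHAPED classes, which are TYPED
(missing-input `Prop`s), NOT attempted; this is not "finishing BSD".

Theorems only (no definition, no new named fact). Bookkeeping that the cell's isogeny levers had been
carrying as an extra hypothesis: every clause of the census predicate
`ClassX1 W p := 2 < p ∧ Red W p ∧ Good W p ∧ Anom W p ∧ ¬(r_an = 0 ∧ GVPar W p)` is invariant under
`ℚ`-isogeny of globally minimal models — reducibility of `E[p]` (a rational line is transported along
an isogeny not killing `E[p]`, x1a's `not_hasIrreducibleModPGaloisRep_of_isIsogenous`), good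
reduction (Serre–Tate / *AEC* VII.7.2, tree `IsIsogenous.hasGoodReductionAtPrime_iff`), `a_p`
(Faltings / *AEC* Ex. 5.4, tree `frobeniusTrace_eq_of_isIsogenous`), the analytic rank (equal
L-functions, tree `analyticRank_eq_of_isIsogenous'`), and the Greenberg–Vatsal parity type at an
anomalous prime (x1a gen 2/3, `gvPar_iff_of_isIsogenous_of_anom`, Serre's ordinary line a theorem).
Hence `ClassX1 W p ↔ ClassX1 W' p` for `W ∼ W'`, and the gen-1/gen-5 isogeny levers need the class
hypothesis on ONE curve only:

* `Anom.of_isIsogenous`, `anom_iff_of_isIsogenous`; `ClassX1.of_isIsogenous`,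
  `classX1_iff_of_isIsogenous`;
* `X1.bsdp_of_exists_torsion_of_isIsogenous'` — gen 5's rank-`0` Cassels-certificate lever with
  `ClassX1 W p` on the curve itself and the certificate on any isogenous `W'` (census: `10406j1@3` via
  `10406j2`, `15059d1@3` via `15059d2`);
* `X1.bsdp_of_shaAn_unit_of_isIsogenous'` — gen 1's lever L8 (`p ∤ #Ш(E'/ℚ)_an` for an isogenous
  `E'`) in the same one-hypothesis shape.

References: Silverman AEC VII.7.2, Ex. 5.4 [SilvermanAEC2009]; Faltings 1983 §5 [Faltings1983Endlichkeit];
Greenberg–Vatsal 2000 Thm. 1.3 [GreenbergVatsal2000]; Wuthrich 2014 Prop. 21 [Wuthrich2014];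
Milne ADT I.7.3 [MilneADT2006]; cell files `b2b-bsdres-x1b/X1-B.md` §10, `b2b-bsdres-x1a/X1-CENSUS-g2.md` §2e.
-/

set_option autoImplicit false

noncomputable section

open scoped Classical

open WeierstrassCurve Literature.NumberTheory.EllipticCurves
  Literature.NumberTheory.EllipticCurves.Wuthrich2014
  Literature.NumberTheory.EllipticCurves.Rank1Residual.Typed

namespace Literature.NumberTheory.EllipticCurves.Rank1Residual

variable {W W' : WeierstrassCurve ℚ} [W.IsElliptic] [W'.IsElliptic] [W.IsGloballyMinimal]
  [W'.IsGloballyMinimal] {p : ℕ} [Fact p.Prime]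

/-! ### The clauses of `ClassX1` along a `ℚ`-isogeny -/

/-- **`anom(p)` is a `ℚ`-isogeny invariant** (globally minimal models): reducibility of `E[p]` is
transported along an isogeny not killing `E[p]`, good reduction at `p` is isogeny-invariant
(Serre–Tate), and `a_p(E) = a_p(E')` at a good prime (Faltings), so `p ∣ a_p − 1` transports.
[cite: SilvermanAEC2009, Cor. VII.7.2 and Ex. 5.4] [cite: Faltings1983Endlichkeit, §5 Korollar 2] -/
theorem Anom.of_isIsogenous (h : IsIsogenous W W') (hA : Anom W p) : Anom W' p := by
  obtain ⟨hred, hgood, hap⟩ := hA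
  have hgood' : W'.HasGoodReductionAtPrime p := (h.hasGoodReductionAtPrime_iff p).mp hgood
  refine ⟨not_hasIrreducibleModPGaloisRep_of_isIsogenous h hred, hgood', ?_⟩
  rwa [← frobeniusTrace_eq_of_isIsogenous h p hgood hgood']

/-- `anom(p)` on `W` iff on an isogenous `W'`. [cite: SilvermanAEC2009, Cor. VII.7.2 and Ex. 5.4] -/
theorem anom_iff_of_isIsogenous (h : IsIsogenous W W') : Anom W p ↔ Anom W' p :=
  ⟨Anom.of_isIsogenous h, Anom.of_isIsogenous h.symm_of_charZero⟩

/-- **Class X1 is a property of the `ℚ`-isogeny class**: for globally minimal `W ∼ W'` and a prime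
`p`, `ClassX1 W p → ClassX1 W' p`. The clause `¬(r_an = 0 ∧ gvpar)` transports because the analytic
rank is an isogeny invariant (equal L-functions) and the Greenberg–Vatsal parity type is an isogeny
invariant at an anomalous odd prime (x1a, `gvPar_iff_of_isIsogenous_of_anom`).
[cite: SilvermanAEC2009, Cor. VII.7.2 and Ex. 5.4] [cite: GreenbergVatsal2000, Thm. 1.3 (the parity condition)] -/
theorem ClassX1.of_isIsogenous (h : IsIsogenous W W') (hX : ClassX1 W p) : ClassX1 W' p := by
  obtain ⟨hp, hred, hgood, hanom, hgv⟩ := hX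
  have hanom' : Anom W' p := Anom.of_isIsogenous h hanom
  have hp2 : p ≠ 2 := by omega
  refine ⟨hp, not_hasIrreducibleModPGaloisRep_of_isIsogenous h hred,
    (h.hasGoodReductionAtPrime_iff p).mp hgood, hanom', ?_⟩
  rintro ⟨hr0', hG'⟩
  exact hgv ⟨(analyticRank_eq_of_isIsogenous' h).trans hr0',
    (gvPar_iff_of_isIsogenous_of_anom hp2 hanom hanom' h).mpr hG'⟩

/-- `ClassX1 W p ↔ ClassX1 W' p` for `ℚ`-isogenous globally minimal `W, W'`.
[cite: SilvermanAEC2009, Cor. VII.7.2 and Ex. 5.4] [cite: GreenbergVatsal2000, Thm. 1.3 (the parity condition)] -/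
theorem classX1_iff_of_isIsogenous (h : IsIsogenous W W') : ClassX1 W p ↔ ClassX1 W' p :=
  ⟨ClassX1.of_isIsogenous h, ClassX1.of_isIsogenous h.symm_of_charZero⟩

/-! ### The isogeny levers with the class hypothesis on one curve only -/

/-- **Gen 5's rank-`0` certificate lever, one-hypothesis shape:** `W.analyticRank ≤ 1 → ClassX1 W p →
W.analyticRank = 0 →` (for some `ℚ`-isogenous globally minimal `W'`: `ord_p #Ш(W'/ℚ)_an ≤ 2` and a
non-zero element of `Ш(W'/ℚ)` killed by `p`) `→ BSDp W p`. Inputs: Cassels–Tate (`hCT`), Wuthrich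
Prop. 21 (`hW`), Gross–Zagier–Kolyvagin (`hGZK`), modularity (`hmod`), Cassels' isogeny invariance
(`hCassels`) — all PUBLISHED; the class hypothesis is moved to `W'` by `ClassX1.of_isIsogenous`.
Census: `10406j1@3` (certificate on `10406j2`), `15059d1@3` (on `15059d2`).
[cite: Wuthrich2014, Prop. 21 (p. 400)] [cite: SilvermanAEC2009, Thm. X.4.14]
[cite: MilneADT2006, Thm. I.7.3] -/
theorem X1.bsdp_of_exists_torsion_of_isIsogenous' (hCT : exists_casselsTate_pairing (K := ℚ))
    (hW : sha_dvd_analyticSha) (hGZK : rank_eq_analyticRank_of_analyticRank_le_one)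
    (hmod : hasEntireLFunction_rat) (hCassels : bsdRHS_eq_of_isIsogenous)
    (W W' : WeierstrassCurve ℚ) [W.IsElliptic] [W'.IsElliptic] [W.IsGloballyMinimal]
    [W'.IsGloballyMinimal] (hiso : IsIsogenous W W') (p : ℕ) [Fact p.Prime]
    (hr : W.analyticRank ≤ 1) (hX : ClassX1 W p) (hr0 : W.analyticRank = 0)
    {q' : ℚ} (hq' : shaAn W' = (q' : ℂ)) (hv' : padicValRat p q' ≤ 2)
    (hx' : ∃ x : W'.sha, x ≠ 0 ∧ p • x = 0) : BSDp W p :=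
  X1.bsdp_of_casselsTate_of_exists_torsion_of_isIsogenous hCT hW hGZK hmod hCassels W W' hiso p hr
    (ClassX1.of_isIsogenous hiso hX) hr0 hq' hv' hx'

/-- **Gen 1's lever L8, one-hypothesis shape:** `W.analyticRank ≤ 1 → ClassX1 W p →
W.analyticRank = 0 →` (`p ∤ #Ш(W'/ℚ)_an` for some `ℚ`-isogenous globally minimal `W'`) `→ BSDp W p`
(Wuthrich Prop. 21 for `W'`, Cassels' invariance; the class hypothesis on `W` only). Census: the 8
rank-`0` X1 pairs `2366d1, 7154c1, 10621c1, 11830b1, 12194d1, 13826e1, 15314e1, 15314h1 @3`.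
[cite: Wuthrich2014, Prop. 21 (p. 400)] [cite: MilneADT2006, Thm. I.7.3] [cite: BCDTJAMS2001, Theorem A] -/
theorem X1.bsdp_of_shaAn_unit_of_isIsogenous' (hW : sha_dvd_analyticSha)
    (hGZK : rank_eq_analyticRank_of_analyticRank_le_one) (hmod : hasEntireLFunction_rat)
    (hCassels : bsdRHS_eq_of_isIsogenous)
    (W W' : WeierstrassCurve ℚ) [W.IsElliptic] [W'.IsElliptic] [W.IsGloballyMinimal]
    [W'.IsGloballyMinimal] (hiso : IsIsogenous W W') (p : ℕ) [Fact p.Prime]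
    (hr : W.analyticRank ≤ 1) (hX : ClassX1 W p) (hr0 : W.analyticRank = 0)
    (hunit' : ∃ q : ℚ, shaAn W' = (q : ℂ) ∧ padicValRat p q = 0) : BSDp W p :=
  bsdp_of_classX1_of_L_one_ne_zero_of_isIsogenous hW hGZK hCassels W W' hiso p hr
    (ClassX1.of_isIsogenous hiso hX) ((W.analyticRank_eq_zero_iff_holds (hmod W)).mp hr0) hunit'

end Literature.NumberTheory.EllipticCurves.Rank1Residual

end
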